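import Literature.AnabelianGeometry.EtaleTheta.ThetaSystems
import Mathlib.Topology.Instances.ZMod
import Mathlib.Data.Nat.Factorial.Basic
import Mathlib.Data.ZMod.Basic
import Mathlib.Data.Int.Cast.Lemmas
import Mathlib.Algebra.Group.Int.Units
import Mathlib.GroupTheory.OrderOfElement

/-!
# [EtTh] §2: Cor 2.16 as typed (`ThetaEnvTower.Cor216`) is a SCHEMA — a kernel refutation of its
# universal closure at one explicit CHIRAL degenerate `ThetaEnvTower` (FACT-LIST triage, rule R5)

Mochizuki, *The Étale Theta Function and its Frobenioid-theoretic Manifestations* [EtTh], Publ. RIMS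
45 (2009), §2, Cor 2.16 "Profinite Non-discreteness of Bi-theta Environments", PRIMS pp.53–54
(printed pp.279–280; locators `p.N` = PDF pages of the PRIMS text; bib key `MochizukiEtTh2009`).
PROOF-ONLY companion (no `def`, no new named fact, no instance) of `ThetaSystems.lean` (seat
abc-iut-L2-t2: the interface `ThetaEnvTower E` and the named fact `ThetaEnvTower.Cor216`; nothing there
is edited or restated). Cell `abc-iut`, block F fact-proving wave, seat abc-iut-f-153 (tranche 153),
FROZEN FACT-LIST row **F-0646** `Literature.AnabelianGeometry.EtaleTheta.ThetaEnvTower.Cor216`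
(kernel_closedness = parametrised).

THE QUESTION. `Cor216` is a PREDICATE on the lawless interface `ThetaEnvTower E` (an abstract augmented
topological group `Π_X ↠ G_K` with `Π_Y ⊇ Π_Ÿ`, cyclotomes `μ_M`, theta cocycles, reductions). Seat
abc-iut-L2-t2 proved it from ONE input beyond the interface — the bi-theta symmetry clause of
Prop 2.14 (iii) in cocycle form (`ThetaEnvTower.cor216_of`, binder `hshift`; discharged for the §1 MODEL
from Prop 1.5 (ii), (iii) in `Discharge/Sec2Cor216OfModel.lean`, `cor216_of_model_of_prop15`). The
degenerate tower of `Discharge/Sec2TowerSchemaNegative.lean` (seat abc-iut-w5-d071: `Π_Ÿ = 1`, trivial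
character) SATISFIES `Cor216` (clause (b) is vacuous there), and so does every ABELIAN degenerate tower:
the automorphism `−1` of `Π_Y` at level `1` absorbs the `Gal(Y/X)`-twist of clause (b). So the R5
status of F-0646 ("is the universal closure a theorem of the interface?") was open.

THE ANSWER: NO (`not_forall_cor216`). Witness (`exists_chiral_tower_not_cor216`): the tower over the
factorial levels `E = {k!}` with `Π_X = ℤ × (Q × ℤ/2)` (discrete), `Q = ℤ/7 ⋊ ℤ` (the generator `t` of
`ℤ` acting on `ℤ/7` by squaring: `t b t⁻¹ = b²`), `Π_Y = 0 × (Q × ℤ/2)`, `Π_Ÿ = 0 × (Q × 0) ≅ Q`,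
`G_K = ℤ/2` (the parity of the `ℤ`-coordinate) acting on `μ_M = ℤ/M` by INVERSION, the single mod-`M`
theta cocycle `η_M = (Π_Ÿ ≅ Q ↠ ℤ → μ_M, n ↦ ζ_M^n)` (a genuine compatible family of continuous
cocycles, full coboundary classes since `G_K` acts trivially on `Π_Ÿ`-values), genuine reductions
`ℤ/M' ↠ ℤ/M`; all forty-odd interface axioms are PROVED. The group `Q` is CHIRAL
(`right_eq_of_mulEquiv_sqSemidirect`): every automorphism of `Q` induces the IDENTITY on the quotient
`Q ↠ ℤ` (the torsion subgroup `ℤ/7` is characteristic, so an automorphism induces `±1` on `ℤ`, and `−1`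
would conjugate `×2` into `×4 = (×2)⁻¹` on `ℤ/7`, which is absurd since `b ↦ b⁴ = b²` forces `b = 1`).
Now take the compatible residues `j_M = 1`. Clause (b) of `Cor216` at level `M = 6 ∈ E` asks for
`ψ ∈ Aut(Π_Ÿ)`, `c ∈ μ_6` with `η_6 ∘ ψ⁻¹ = (x_6 · η_6) · ∂c`, where `x_6 ∈ Π_X` maps to
`k_6 ≡ j_6 = 1 (mod 6)` in `Gal(Y/X) ≅ ℤ`; `k_6` is odd, so `x_6` acts on `μ_6` by inversion and
(conjugation inducing the identity on `Q ↠ ℤ`) `x_6 · η_6 = η_6⁻¹`; `∂c = 1` on `Π_Ÿ`; and by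
chirality `η_6 ∘ ψ⁻¹ = η_6`. At the generator `t` this reads `ζ_6 = ζ_6⁻¹` — false.

HONEST FRAMING. This refutes the universal closure of a TYPED predicate over an abstract interface;
it says NOTHING about [EtTh] Cor 2.16 (a refereed theorem about the tempered fundamental group of a
once-punctured elliptic curve, whose printed proof uses exactly the bi-theta symmetry that the
interface does not carry), and nothing about the §1 model, where `Cor216` IS a theorem modulo the
named §1 facts Prop 1.5 (ii), (iii) (`cor216_of_model_of_prop15`). Per rule R5 the row F-0646 is
consumable AT NAMED INSTANCES ONLY; it has no consumer in the [IUTchIII] Cor 3.12 cone (leaf node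
`N_EtTh_Cor2_16`). No side is taken on [IUTchIII] Cor 3.12; typed ≠ proved.
-/

namespace Literature.AnabelianGeometry.EtaleTheta

open Multiplicative SemidirectProduct

namespace ThetaEnvTower

/-! ## The chiral group `ℤ/7 ⋊ ℤ` -/

/-- **Chirality of `Q = ℤ/7 ⋊ ℤ`** (the generator of `ℤ` acting on `μ_7 = ℤ/7` by squaring, i.e.
`φ = n ↦ σⁿ` with `σ a = a²`): every automorphism `ψ` of `Q` induces the IDENTITY on the quotient
`Q ↠ ℤ` — the torsion subgroup `ℤ/7` is characteristic, so `ψ` induces `±1` on `ℤ`, and `−1` would turn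
the relation `t b t⁻¹ = b²` into `a⁴ = a²` for `a = ψ(b) ≠ 1` of order `7`. (Auxiliary group theory for
the schema witness below; the group is the `Π_Ÿ` of the chiral degenerate tower.)
[cite: MochizukiEtTh2009, Cor 2.16 p.53] -/
theorem right_eq_of_mulEquiv_sqSemidirect (σ : MulAut (Multiplicative (ZMod 7)))
    (hσ : ∀ a, σ a = a ^ 2)
    (ψ : (Multiplicative (ZMod 7) ⋊[zpowersHom (MulAut (Multiplicative (ZMod 7))) σ]
        Multiplicative ℤ) ≃*
      (Multiplicative (ZMod 7) ⋊[zpowersHom (MulAut (Multiplicative (ZMod 7))) σ]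
        Multiplicative ℤ))
    (q : Multiplicative (ZMod 7) ⋊[zpowersHom (MulAut (Multiplicative (ZMod 7))) σ]
      Multiplicative ℤ) :
    (ψ q).right = q.right := by
  -- finite facts in `μ_7`
  have h7 : ∀ a : Multiplicative (ZMod 7), a ^ 7 = 1 := by decide
  have h42 : ∀ a : Multiplicative (ZMod 7), a ^ 4 = a ^ 2 → a = 1 := by decide
  have h8 : ∀ a : Multiplicative (ZMod 7), (a ^ 4) ^ 2 = a := by decide
  have hb1 : (ofAdd (1 : ZMod 7) : Multiplicative (ZMod 7)) ≠ 1 := by decide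
  have hσ' : ∀ a, σ.symm a = a ^ 4 := fun a => by rw [MulEquiv.symm_apply_eq, hσ, h8]
  -- (1) elements of finite order have trivial image in `ℤ`
  have hfin : ∀ w : Multiplicative (ZMod 7) ⋊[zpowersHom (MulAut (Multiplicative (ZMod 7))) σ]
      Multiplicative ℤ, IsOfFinOrder w → w.right = 1 := by
    intro w hw
    have h := rightHom.isOfFinOrder hw
    rw [isOfFinOrder_iff_pow_eq_one] at h
    obtain ⟨n, hn, hpow⟩ := h
    change w.right ^ n = 1 at hpow
    have hz : (n : ℤ) * w.right.toAdd = 0 := by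
      have := congrArg Multiplicative.toAdd hpow
      rwa [toAdd_pow, toAdd_one, nsmul_eq_mul] at this
    rcases mul_eq_zero.mp hz with h | h
    · exact absurd h (by exact_mod_cast hn.ne')
    · rw [← ofAdd_toAdd w.right, h]; rfl
  -- (2) hence `ψ` maps the torsion subgroup `μ_7` into itself
  have hinl : ∀ a : Multiplicative (ZMod 7), (ψ (inl a)).right = 1 := fun a =>
    hfin _ (ψ.toMonoidHom.isOfFinOrder
      (isOfFinOrder_iff_pow_eq_one.2 ⟨7, by norm_num, by rw [← map_pow, h7, map_one]⟩))
  -- (3) the induced endomorphism of the quotient `ℤ` is multiplication by `m`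
  have hgen : ∀ z : Multiplicative ℤ, z = ofAdd (1 : ℤ) ^ z.toAdd := fun z => by
    rw [← ofAdd_zsmul, smul_eq_mul, mul_one, ofAdd_toAdd]
  set m : ℤ := (ψ (inr (ofAdd (1 : ℤ)))).right.toAdd with hm
  have hψr : ∀ w : Multiplicative (ZMod 7) ⋊[zpowersHom (MulAut (Multiplicative (ZMod 7))) σ]
      Multiplicative ℤ, (ψ w).right = ofAdd (w.right.toAdd * m) := by
    intro w
    have e1 : inl w.left * inr (ofAdd (1 : ℤ)) ^ w.right.toAdd = w := by
      rw [← map_zpow, ← hgen, inl_left_mul_inr_right]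
    change rightHom (ψ w) = _
    rw [show rightHom (ψ w) = rightHom (ψ (inl w.left * inr (ofAdd (1 : ℤ)) ^ w.right.toAdd)) by
      rw [e1], map_mul, map_mul, map_zpow, map_zpow]
    change (ψ (inl w.left)).right * (ψ (inr (ofAdd (1 : ℤ)))).right ^ w.right.toAdd = _
    rw [hinl, one_mul, ← ofAdd_toAdd (ψ (inr (ofAdd (1 : ℤ)))).right, ← hm, ← ofAdd_zsmul,
      smul_eq_mul]
  -- (4) `ψ` is onto, so `m = ±1`
  have hm1 : m = 1 ∨ m = -1 := by
    obtain ⟨w, hw⟩ := ψ.surjective (inr (ofAdd (1 : ℤ)))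
    have h1 := hψr w
    rw [hw, right_inr] at h1
    have h2 : w.right.toAdd * m = 1 := by
      have := congrArg Multiplicative.toAdd h1
      rw [toAdd_ofAdd, toAdd_ofAdd] at this
      exact this.symm
    rw [mul_comm] at h2
    exact Int.eq_one_or_neg_one_of_mul_eq_one h2
  -- (5) `m = -1` is impossible: the relation `t b t⁻¹ = b²` would become `a₀⁴ = a₀²`
  have hconj : ∀ (w : Multiplicative (ZMod 7) ⋊[zpowersHom (MulAut (Multiplicative (ZMod 7))) σ]
      Multiplicative ℤ) (a : Multiplicative (ZMod 7)),
      w * inl a * w⁻¹ = inl ((zpowersHom (MulAut (Multiplicative (ZMod 7))) σ) w.right a) := by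
    intro w a
    apply SemidirectProduct.ext
    · simp only [mul_left, mul_right, inv_left, left_inl, right_inl, mul_one]
      rw [← MulAut.mul_apply, ← map_mul, mul_inv_cancel, map_one, MulAut.one_apply,
        mul_inv_cancel_comm]
    · simp only [mul_right, inv_right, right_inl, mul_one, mul_inv_cancel]
  rcases hm1 with hm1 | hm1
  · rw [hψr, hm1, mul_one, ofAdd_toAdd]
  · exfalso
    set b : Multiplicative (ZMod 7) ⋊[zpowersHom (MulAut (Multiplicative (ZMod 7))) σ]
      Multiplicative ℤ := inl (ofAdd (1 : ZMod 7)) with hb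
    set t : Multiplicative (ZMod 7) ⋊[zpowersHom (MulAut (Multiplicative (ZMod 7))) σ]
      Multiplicative ℤ := inr (ofAdd (1 : ℤ)) with ht
    have hrel : t * b * t⁻¹ = b ^ 2 := by
      have := inl_aut (φ := zpowersHom (MulAut (Multiplicative (ZMod 7))) σ)
        (ofAdd (1 : ℤ)) (ofAdd (1 : ZMod 7))
      rw [zpowersHom_apply, toAdd_ofAdd, zpow_one, hσ, map_pow] at this
      rw [ht, ← map_inv]
      exact this.symm
    -- `ψ b = inl a₀` with `a₀ ≠ 1`
    have hψb : ψ b = inl (ψ b).left := by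
      apply SemidirectProduct.ext
      · rfl
      · rw [right_inl]; exact hinl _
    have ha0 : (ψ b).left ≠ 1 := fun h0 => by
      have : ψ b = 1 := by rw [hψb, h0, map_one]
      rw [map_eq_one_iff ψ ψ.injective, hb, ← map_one inl, inl_inj] at this
      exact hb1 this
    have hψt : (ψ t).right = ofAdd m := by rw [hm, ofAdd_toAdd]
    have key := congrArg ψ hrel
    rw [map_pow, map_mul, map_mul, map_inv, hψb, hconj, hψt, ← map_pow, inl_inj,
      zpowersHom_apply, toAdd_ofAdd, hm1, zpow_neg_one, MulAut.inv_apply, hσ'] at key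
    exact ha0 (h42 _ key)

/-! ## The chiral degenerate tower and the refutation -/

set_option maxRecDepth 8192 in
/-- **One chiral degenerate tower at which `Cor216` FAILS.** Over the factorial levels `E = {k!}`:
`Π_X = ℤ × (Q × ℤ/2)` discrete with `Q = ℤ/7 ⋊ ℤ` (squaring action), `Π_Y = 0 × (Q × ℤ/2)`,
`Π_Ÿ = 0 × (Q × 0)`, `G_K = ℤ/2` = parity of the `ℤ`-coordinate acting on `μ_M = ℤ/M` by inversion,
theta cocycle `η_M = ζ_M^{deg}` (`deg : Π_Ÿ ≅ Q ↠ ℤ`), reductions `ℤ/M' ↠ ℤ/M`, `(l·Δ_Θ) := Π_X` with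
`thetaMod_M =` the `ℤ`-coordinate mod `M`. For the compatible residues `j ≡ 1`, clause (b) of `Cor216`
at level `6` would give `ζ_6 = ζ_6⁻¹`. [cite: MochizukiEtTh2009, Cor 2.16 p.53] -/
theorem exists_chiral_tower_not_cor216 : ∃ (E : Set ℕ+) (T : ThetaEnvTower.{0} E), ¬ T.Cor216 := by
  classical
  /- the levels `E = {k!}` -/
  let fac : ℕ → ℕ+ := fun k => ⟨k.factorial, k.factorial_pos⟩
  let E : Set ℕ+ := Set.range fac
  have hE1 : (1 : ℕ+) ∈ E := ⟨0, rfl⟩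
  have hE6 : (6 : ℕ+) ∈ E := ⟨3, PNat.eq rfl⟩
  have hdvd : ∀ {M M' : E}, (M : ℕ+) ∣ (M' : ℕ+) → ((M : ℕ+) : ℕ) ∣ ((M' : ℕ+) : ℕ) := PNat.dvd_iff.1
  /- the chiral group `Q = ℤ/7 ⋊ ℤ` (generator acting by squaring) -/
  have hN8 : ∀ a : Multiplicative (ZMod 7), (a ^ 2) ^ 4 = a ∧ (a ^ 4) ^ 2 = a := by decide
  let σ : MulAut (Multiplicative (ZMod 7)) :=
    { toFun := fun a => a ^ 2
      invFun := fun a => a ^ 4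
      left_inv := fun a => (hN8 a).1
      right_inv := fun a => (hN8 a).2
      map_mul' := fun a b => mul_pow a b 2 }
  have hσ : ∀ a, σ a = a ^ 2 := fun _ => rfl
  let Q : Type := Multiplicative (ZMod 7) ⋊[zpowersHom (MulAut (Multiplicative (ZMod 7))) σ]
    Multiplicative ℤ
  /- the groups `Π_X = ℤ × (Q × ℤ/2) ⊇ Π_Y = 1 × (Q × ℤ/2) ⊇ Π_Ÿ = 1 × (Q × 1)`, all discrete -/
  let C : Type := Multiplicative ℤ × (Q × Multiplicative (ZMod 2))
  letI : TopologicalSpace C := ⊥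
  haveI : DiscreteTopology C := discreteTopology_bot C
  let fstHom : C →* Multiplicative ℤ := MonoidHom.fst _ _
  let sndHom : C →* Multiplicative (ZMod 2) :=
    (MonoidHom.snd Q (Multiplicative (ZMod 2))).comp (MonoidHom.snd (Multiplicative ℤ) _)
  have hfst_surj : Function.Surjective fstHom := fun z => ⟨(z, 1), rfl⟩
  let PiY : Subgroup C := fstHom.ker
  let PiYdd : Subgroup C := sndHom.ker ⊓ PiY
  have hPiY : ∀ x : C, x ∈ PiY ↔ x.1 = 1 := fun x => MonoidHom.mem_ker
  have hPiYdd : ∀ x : C, x ∈ PiYdd ↔ x.2.2 = 1 ∧ x.1 = 1 := fun x => by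
    rw [Subgroup.mem_inf, MonoidHom.mem_ker, MonoidHom.mem_ker]; exact Iff.rfl
  have hidx : (PiYdd.subgroupOf PiY).index = 2 := by
    change PiYdd.relIndex PiY = 2
    rw [Subgroup.inf_relIndex_right, Subgroup.relIndex_ker]
    have hmap : PiY.map sndHom = ⊤ :=
      top_le_iff.mp fun a _ => ⟨(1, (1, a)), (hPiY _).2 rfl, rfl⟩
    rw [hmap, Subgroup.card_top, Nat.card_eq_fintype_card]
    rfl
  /- the Galois group `G_K = ℤ/2`, the parity augmentation and the inversion character -/
  let ε : Multiplicative (ZMod 2) := ofAdd 1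
  have hM2 : ∀ e : Multiplicative (ZMod 2), e = 1 ∨ e = ε := by decide
  have hεne : ε ≠ 1 := by decide
  have hεε : ε * ε = 1 := by decide
  let aug : C →* Multiplicative (ZMod 2) := (Int.castAddHom (ZMod 2)).toMultiplicative.comp fstHom
  have haug : ∀ x : C, aug x = ofAdd (((toAdd x.1 : ℤ)) : ZMod 2) := fun _ => rfl
  have haug_surj : Function.Surjective aug := fun e => by
    obtain ⟨k, hk⟩ := ZMod.intCast_surjective (toAdd e)
    exact ⟨(ofAdd k, 1), by rw [haug, toAdd_ofAdd, hk, ofAdd_toAdd]⟩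
  have haugY : ∀ g : PiYdd, aug (g : C) = 1 := fun g => by
    rw [haug, ((hPiYdd _).1 g.2).2, toAdd_one, Int.cast_zero, ofAdd_zero]
  have hinv2 : ∀ (A : Type) [CommGroup A], MulEquiv.inv A * MulEquiv.inv A = 1 := fun A _ => by
    ext a; simp
  let chi : ∀ (A : Type) [CommGroup A], Multiplicative (ZMod 2) →* MulAut A := fun A _ =>
    { toFun := fun e => if e = 1 then 1 else MulEquiv.inv A
      map_one' := if_pos rfl
      map_mul' := fun e e' => by
        rcases hM2 e with rfl | rfl <;> rcases hM2 e' with rfl | rfl <;>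
          simp [hεne, hεε, hinv2] }
  have hchiε : ∀ (A : Type) [CommGroup A] (a : A), chi A ε a = a⁻¹ := fun A _ a => by
    change (if ε = 1 then (1 : MulAut A) else MulEquiv.inv A) a = a⁻¹
    rw [if_neg hεne, MulEquiv.inv_apply]
  /- the cyclotomes `μ_M = ℤ/M`, reductions, `thetaMod`, and the theta cocycles `η_M = ζ_M^{deg}` -/
  let red : ∀ M M' : E, (M : ℕ+) ∣ (M' : ℕ+) →
      (Multiplicative (ZMod ((M' : ℕ+) : ℕ)) →* Multiplicative (ZMod ((M : ℕ+) : ℕ))) :=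
    fun M M' h => (ZMod.castHom (hdvd h) (ZMod ((M : ℕ+) : ℕ))).toAddMonoidHom.toMultiplicative
  have hred : ∀ (M M' : E) (h : (M : ℕ+) ∣ (M' : ℕ+)) (a : Multiplicative (ZMod ((M' : ℕ+) : ℕ))),
      red M M' h a = ofAdd (ZMod.cast (toAdd a) : ZMod ((M : ℕ+) : ℕ)) := fun _ _ _ _ => rfl
  have hcast : ∀ (M : E) (a : ZMod ((M : ℕ+) : ℕ)), ∃ k : ℕ, a = k := fun M a => by
    haveI : NeZero ((M : ℕ+) : ℕ) := ⟨(M : ℕ+).ne_zero⟩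
    exact ⟨a.val, (ZMod.natCast_zmod_val a).symm⟩
  let thetaMod : ∀ M : E, (⊤ : Subgroup C) →* Multiplicative (ZMod ((M : ℕ+) : ℕ)) := fun M =>
    ((Int.castAddHom (ZMod ((M : ℕ+) : ℕ))).toMultiplicative.comp fstHom).comp (⊤ : Subgroup C).subtype
  have hthetaMod : ∀ (M : E) (g : (⊤ : Subgroup C)),
      thetaMod M g = ofAdd (((toAdd (g : C).1 : ℤ)) : ZMod ((M : ℕ+) : ℕ)) := fun _ _ => rfl
  let η : ∀ M : E, PiYdd → Multiplicative (ZMod ((M : ℕ+) : ℕ)) := fun M g =>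
    ofAdd (((toAdd (g : C).2.1.right : ℤ)) : ZMod ((M : ℕ+) : ℕ))
  have hη : ∀ (M : E) (g : PiYdd),
      η M g = ofAdd (((toAdd (g : C).2.1.right : ℤ)) : ZMod ((M : ℕ+) : ℕ)) := fun _ _ => rfl
  have hηmul : ∀ (M : E) (g h : PiYdd), η M (g * h) = η M g * η M h := fun M g h => by
    rw [hη, hη, hη, ← ofAdd_add, ← Int.cast_add, ← toAdd_mul]; rfl
  have hηred : ∀ (M M' : E) (h : (M : ℕ+) ∣ (M' : ℕ+)), red M M' h ∘ η M' = η M := fun M M' h => by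
    funext g
    rw [Function.comp_apply, hη, hη, hred M M' h, toAdd_ofAdd, ZMod.cast_intCast (hdvd h)]
  /- the tower -/
  let T : ThetaEnvTower.{0} E :=
    { one_mem := hE1
      cofinal := fun n => ⟨fac n, ⟨n, rfl⟩, PNat.dvd_iff.2 (Nat.dvd_factorial n.pos le_rfl)⟩
      total := by
        rintro _ ⟨a, rfl⟩ _ ⟨b, rfl⟩
        rcases le_total a b with h | h
        · exact Or.inl (PNat.dvd_iff.2 (Nat.factorial_dvd_factorial h))
        · exact Or.inr (PNat.dvd_iff.2 (Nat.factorial_dvd_factorial h))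
      PiX := C
      G := Multiplicative (ZMod 2)
      aug := aug
      aug_surjective := haug_surj
      PiY := PiY
      PiY_normal := inferInstance
      PiY_open := isOpen_discrete _
      galYX := QuotientGroup.quotientKerEquivOfSurjective fstHom hfst_surj
      PiYdd := PiYdd
      PiYdd_le := inf_le_right
      PiYdd_normal := inferInstance
      PiYdd_open := isOpen_discrete _
      index_PiYdd := hidx
      mu := fun M => Multiplicative (ZMod ((M : ℕ+) : ℕ))
      finMu := fun M => @Multiplicative.fintype _ (@ZMod.fintype _ ⟨(M : ℕ+).ne_zero⟩)
      mu_cyclic := fun M => inferInstance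
      card_mu := fun M => by rw [Fintype.card_multiplicative, ZMod.card]
      chi := fun M => chi (Multiplicative (ZMod ((M : ℕ+) : ℕ)))
      chi_ker_open := fun M => isOpen_discrete _
      thetaCocycles := fun M => {η M}
      thetaCocycles_nonempty := fun M => Set.singleton_nonempty _
      isCocycle := fun M η' hη' => by
        rw [Set.mem_singleton_iff] at hη'; subst hη'
        intro g h
        rw [hηmul, MonoidHom.comp_apply, Subgroup.coe_subtype, haugY, map_one, MulAut.one_apply]
      locallyConstant := fun M η' _ => IsLocallyConstant.of_discrete η'
      mul_coboundary_mem := fun M η' hη' c => by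
        rw [Set.mem_singleton_iff] at hη' ⊢; subst hη'
        funext g
        rw [Pi.mul_apply, CycEnvelope.coboundary, MonoidHom.comp_apply, Subgroup.coe_subtype, haugY,
          map_one, MulAut.one_apply, mul_inv_cancel, mul_one]
      red := red
      red_surjective := fun M M' h x => by
        haveI : NeZero ((M : ℕ+) : ℕ) := ⟨(M : ℕ+).ne_zero⟩
        refine ⟨ofAdd (((toAdd x).val : ℕ) : ZMod ((M' : ℕ+) : ℕ)), ?_⟩
        rw [hred M M' h, toAdd_ofAdd, ZMod.cast_natCast (hdvd h), ZMod.natCast_zmod_val, ofAdd_toAdd]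
      red_self := fun M h a => by rw [hred M M h, ZMod.cast_id, ofAdd_toAdd]
      red_comp := fun M M' M'' h h' a => by
        obtain ⟨k, hk⟩ := hcast M'' (toAdd a)
        rw [hred M M'' (h.trans h'), hred M' M'' h', hred M M' h, toAdd_ofAdd, hk,
          ZMod.cast_natCast (hdvd (h.trans h')), ZMod.cast_natCast (hdvd h'),
          ZMod.cast_natCast (hdvd h)]
      red_chi := fun M M' h g a => by
        rcases hM2 g with rfl | rfl
        · rw [map_one, map_one, MulAut.one_apply, MulAut.one_apply]
        · rw [hchiε, hchiε, map_inv]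
      red_cocycle_mem := fun M M' h η' hη' => by
        rw [Set.mem_singleton_iff] at hη' ⊢; subst hη'; exact hηred M M' h
      red_cocycle_surj := fun M M' h η' hη' => by
        rw [Set.mem_singleton_iff] at hη'; subst hη'
        exact ⟨η M', Set.mem_singleton _, hηred M M' h⟩
      lDeltaTheta := ⊤
      thetaMod := thetaMod
      thetaMod_surjective := fun M x => by
        haveI : NeZero ((M : ℕ+) : ℕ) := ⟨(M : ℕ+).ne_zero⟩
        refine ⟨⟨(ofAdd ((toAdd x).val : ℤ), 1), trivial⟩, ?_⟩
        rw [hthetaMod, toAdd_ofAdd, Int.cast_natCast, ZMod.natCast_zmod_val, ofAdd_toAdd]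
      red_thetaMod := fun M M' h g => by
        rw [hthetaMod, hthetaMod, hred M M' h, toAdd_ofAdd, ZMod.cast_intCast (hdvd h)] }
  /- bookkeeping on `T` -/
  let M6 : E := ⟨6, hE6⟩
  have hηmem : ∀ M : E, η M ∈ T.thetaCocycles M := fun _ => Set.mem_singleton _
  -- `Π_Ÿ ≅ Q`, so every automorphism of `Π_Ÿ` preserves the degree `Π_Ÿ → Q → ℤ`
  let eQ : PiYdd ≃* Q :=
    { toFun := fun g => (g : C).2.1
      invFun := fun q => ⟨(1, (q, 1)), (hPiYdd _).2 ⟨rfl, rfl⟩⟩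
      left_inv := fun g => by
        obtain ⟨⟨z, q, e⟩, hg⟩ := g
        obtain ⟨he, hz⟩ := (hPiYdd _).1 hg
        change e = 1 at he; change z = 1 at hz
        subst he; subst hz; rfl
      right_inv := fun q => rfl
      map_mul' := fun g h => rfl }
  have hdeg : ∀ (ρ : T.PiYdd ≃* T.PiYdd) (g : T.PiYdd),
      ((ρ g : T.PiYdd) : C).2.1.right = (g : C).2.1.right := fun ρ g => by
    have := right_eq_of_mulEquiv_sqSemidirect σ hσ (eQ.symm.trans (ρ.trans eQ)) (eQ g)
    rwa [MulEquiv.trans_apply, MulEquiv.trans_apply, MulEquiv.symm_apply_apply] at this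
  /- the refutation: for `j ≡ 1`, clause (b) at level `6` forces `ζ_6 = ζ_6⁻¹` -/
  refine ⟨E, T, fun h216 => ?_⟩
  obtain ⟨γ, -, -, -, k, x, hk, hx, hc⟩ :=
    h216 η hηmem hηred (fun M => 1) (fun M M' h => map_one _)
  obtain ⟨ψ, c, -, hlast⟩ := hc M6 (one_dvd _)
  -- the test element `t₀ = (0, (t, 0))`, `t` the generator of the quotient `ℤ` of `Q`
  let t₀ : T.PiYdd := ⟨((1 : Multiplicative ℤ), ((inr (ofAdd (1 : ℤ)) : Q), (1 : Multiplicative (ZMod 2)))),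
    (hPiYdd _).2 ⟨rfl, rfl⟩⟩
  have key := hlast t₀
  -- left-hand side: `η_6 (ψ⁻¹ t₀) = ζ_6`
  have hL : η M6 (ψ.symm t₀) = ofAdd ((1 : ℤ) : ZMod 6) := by
    rw [hη, hdeg ψ.symm t₀]; rfl
  -- the conjugating element `x_6` has odd degree, so it acts on `μ_6` by inversion
  have hk6 : ((k M6 : ℤ) : ZMod 6) = 1 := hk M6
  have hk2 : ((k M6 : ℤ) : ZMod 2) = 1 := by
    have := congrArg (ZMod.castHom (show 2 ∣ 6 by norm_num) (ZMod 2)) hk6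
    rwa [map_intCast, map_one] at this
  have hx6 : (x M6).1 = ofAdd (k M6) := hx M6
  have haugx : T.aug (x M6) = ε := by
    change aug (x M6) = ε
    rw [haug, hx6, toAdd_ofAdd, hk2]
  -- right-hand side: `(x_6 · η_6)(t₀) · ∂c(t₀) = ζ_6⁻¹`
  have hR : T.conjCocycle M6 (x M6) (η M6) t₀ *
      CycEnvelope.coboundary (T.aug.comp T.PiYdd.subtype) (T.chi M6) c t₀ =
        (ofAdd ((1 : ℤ) : ZMod 6))⁻¹ := by
    have hcob : CycEnvelope.coboundary (T.aug.comp T.PiYdd.subtype) (T.chi M6) c t₀ = 1 := by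
      rw [CycEnvelope.coboundary, MonoidHom.comp_apply, Subgroup.coe_subtype]
      change c * (chi _ (aug (t₀ : C)) c)⁻¹ = 1
      rw [haugY, map_one, MulAut.one_apply, mul_inv_cancel]
    rw [hcob, mul_one, ThetaEnvTower.conjCocycle, haugx]
    change chi _ ε (η M6 _) = _
    rw [hchiε, hη]
    have hr : toAdd (((x M6)⁻¹ * (t₀ : C) * x M6).2.1.right) = (1 : ℤ) := by
      change toAdd (SemidirectProduct.right ((x M6).2.1⁻¹ * inr (ofAdd (1 : ℤ)) * (x M6).2.1)) = 1
      rw [mul_right, mul_right, inv_right, inv_mul_cancel_comm, right_inr, toAdd_ofAdd]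
    exact congrArg (fun z : ℤ => (ofAdd ((z : ℤ) : ZMod ((M6 : ℕ+) : ℕ)))⁻¹) hr
  rw [hL, hR] at key
  have h6 : (ofAdd ((1 : ℤ) : ZMod 6) : Multiplicative (ZMod 6)) ≠ (ofAdd ((1 : ℤ) : ZMod 6))⁻¹ := by
    decide
  exact h6 key

/-- **F-0646 SCHEMA-REFUTED**: the universal closure of `ThetaEnvTower.Cor216` ([EtTh] Cor 2.16,
"Profinite Non-discreteness of Bi-theta Environments", as typed over the interface `ThetaEnvTower E`)
is FALSE — rule R5: the row is consumable at NAMED instances only (at the §1 model: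
`ThetaSetting.EtaleThetaData.DoubleUnderline.cor216_of_model_of_prop15`, modulo Prop 1.5 (ii), (iii)).
[cite: MochizukiEtTh2009, Cor 2.16 p.53] -/
theorem not_forall_cor216 : ¬ ∀ (E : Set ℕ+) (T : ThetaEnvTower.{0} E), T.Cor216 := fun h => by
  obtain ⟨E, T, hT⟩ := exists_chiral_tower_not_cor216
  exact hT (h E T)

end ThetaEnvTower

end Literature.AnabelianGeometry.EtaleTheta
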